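import Literature.Barriers.CriticalPhenomena.SupercriticalSAWSpaceFillingProofsNarrow
import Literature.Barriers.CriticalPhenomena.SupercriticalSAWSpaceFillingRefutation
import Mathlib.MeasureTheory.Measure.Portmanteau
import HarnessLib

/-!
# Barrier mechanism, third audit: space-filling curve laws are weakly CLOSED — the
# supercritical side gives no access to SLE_{8/3} in the curve topology even as an iterated
# limit (`δ → 0` at fixed `x > x_c` first, then `x ↓ x_c`)

Barrier catalogue `Literature/Barriers/CriticalPhenomena/` (D-0021); third audit (2026-08-15,
refuter, "barrier-audit" gen 3) of the mechanism file `…Proofs` of `SupercriticalSAWSpaceFilling`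
(= Theorem 1 of H. Duminil-Copin, G. Kozma, A. Yadin, *Supercritical self-avoiding walks are
space-filling*, Ann. IHP Probab. Stat. 50 (2014) 315–326, arXiv:1110.3074 — PROVED in the tree,
`SupercriticalSAWSpaceFilling_holds`). The first audit (`…Narrow`) narrowed the technique class
along the fugacity axis (δ-independent neighbourhoods of `x_c` only; windows `o(δ²)` are
equivalent to the sub-problem), the second (`…ProofsNarrow`) proved the sharp reach of the
mechanism in the curve topology ("limits in law of weakly space-filling SAW laws are a.s. ONTO
the domain", `SupercriticalSAW.ae_subset_range_of_tendstoLaw`) and its blindness to initial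
segments. Outcome of this audit: **CONFIRMED at page level; one remaining reading of
"near-critical approximation" in the technique class — the iterated limit `lim_{x ↓ x_c}
lim_{δ → 0}` — is closed by a proved closedness statement; nothing is narrowed.**

## What the audit found

1. **Confirmed (page level, arXiv texts).** DKY: the weak sense of space-filling and "It should
   be the Schramm-Löwner Evolution of parameter 8" (p. 2, §1), Theorem 1 verbatim (p. 2),
   Proposition 3 with the Hammersley–Welsh bound `e^{-c√n} μⁿ ≤ b_n ≤ μⁿ` and Lemma 5
   (`a_n ≥ μⁿ e^{-c√n}` for squared walks, p. 4), "We know that the curve becomes space-filling,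
   yet we have very little additional information", Problems 9–10, Conjecture 11 (p. 8, §4).
   The two SLE inputs of the `blocks:` line: [LSW03] §6, first theorem ("Let `γ` be the
   SLE_{8/3} path starting at the origin and `A ∈ 𝒬*`, then `P[γ[0,∞) ∩ A = ∅] = Φ'_A(0)^{5/8}`",
   arXiv p. 14 = Thm 6.1 of the journal numbering) and [RS05] §6, first theorem ("In the range
   `κ ∈ [0,4]`, the SLE_κ trace `γ` is a.s. a simple path and `γ[0,∞) ⊆ ℍ ∪ {0}`", arXiv p. 13
   = Thm 6.1). `SupercriticalSAWSpaceFilling.not_robustSAWScalingLimit` has axiom closure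
   `{propext, Classical.choice, Quot.sound}` with exactly these two facts as hypotheses. The
   citations of `…ProofsNarrow` were re-checked: [LSW04] Prediction 1 (p. 17) and Kesten's
   relation `Σ λ_n β^{-n} = 1` (p. 18, Appendix); [KS17] p. 3 (two routes), p. 5 (Cor. 1.5),
   p. 28 (§4.5, UST Peano counterexample). One prose point of `…ProofsNarrow` (iv) is imprecise,
   not wrong: the chordal chain up to capacity `T` is a functional of the curve up to the
   capacity-`T` time, which precedes the first visit of a small ball at `b` only on an event (a
   curve may creep towards `b` along `∂D` with small capacity); the logical point — the
   CONCLUSION of Theorem 1 implies nothing about prefix laws — is the proved surgery statement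
   and stands.
2. **Closed, not narrowed: the iterated supercritical limit (proved here).** The technique class
   of the barrier reads "fugacity-robust … near-critical-approximation, δ-uniform". Two readings
   were covered by declarations — a δ-independent neighbourhood (`RobustSAWScalingLimit`,
   refuted) and a mesh-coordinated window `x(δ) → x_c` (`WindowRobustSAWScalingLimit`, `…Narrow`)
   — but not the third natural one: take the scaling limit `μ_x = lim_{δ→0} P_{x,δ}` at each
   FIXED `x > x_c` (where it exists) and then let `x ↓ x_c`, hoping to reach the critical law
   along continuum objects (the supercritical phase being the one with a structure theorem).
   In the curve topology this is obstructed as well, by a soft fact proved below: the set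
   `{c | Ω ⊆ trace c}` of curve classes onto a set `Ω` is CLOSED (`isClosed_setOf_subset_range`:
   `z ∈ trace c ⇔ dist(z, trace c) = 0`, traces being compact, and `c ↦ dist(z, trace c)` is
   `1`-Lipschitz, `lipschitzWith_infDist_range` of `…Proofs`), so by the closed-set half of the
   portmanteau theorem (Billingsley 1999, Thm 2.1; Mathlib
   `ProbabilityMeasure.limsup_measure_closed_le_of_tendsto`) probability laws carried by
   space-filling curves are closed under weak convergence (`ae_subset_range_of_tendsto`).
   Combined with `…ProofsNarrow` (each `μ_x`, `x > x_c`, is carried by curves onto `𝔻`,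
   Theorem 1): every weak limit point of the `μ_{x_k}`, along ANY family of supercritical
   fugacities and endpoints, is carried by curves onto the domain
   (`IsSpaceFillingLaws.ae_subset_range_of_iterated`), hence is not a chordal SLE_κ law for any
   `κ` without a.s.-onto curves (`IsSpaceFillingLaws.not_isSLELaw_of_iterated`; all `κ < 8`
   [cite: RohdeSchramm2005, Thm 8.1]) — for SLE_{8/3} in `(𝔻; 1, -1)` unconditionally but for
   the two SLE facts above (`not_isSLELaw_eightThirds_of_supercritical_iterated`). So "approach
   `x_c` from above through continuum limits" joins the obstructed class in the topologies `d`
   and `d_H`; in the driving-function / Carathéodory topology it is as unobstructed as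
   evasion (iv) of `…ProofsNarrow` (SLE_κ driving functions `√κ B` are even continuous in `κ`).
3. **Scope remarks (recorded, not claimed as theorems).** (a) The blocked shrinking window
   `w₀(δ) → 0` of `…Narrow` is inexplicit only because Proposition 3 is printed as
   `limsup Z_m(x) = ∞`; its proof (Lemma 5, p. 4) is effective — `a_n xⁿ ≥ (xμ)ⁿ e^{-c√n}`
   exceeds any constant once `n ≳ (c / log(xμ))²` — so a box size `m(x)` polynomial in
   `(x - x_c)⁻¹` and an explicit algebraic blocked window are within reach of the printed
   argument; the conjectural crossover `δ^{4/3}` [cite: LawlerSchrammWerner2004SAW, Prediction 2]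
   is far below anything this yields. (b) Literature search (arXiv, 2011–2026: "supercritical /
   space-filling / dense self-avoiding walk", "critical fugacity universality", "off-critical
   SAW") found no work evading or contradicting Theorem 1; Problem 10 (the critical walk is not
   space-filling) remains open; robustness ALONG THE CRITICAL MANIFOLD of a multi-parameter
   family — the Yang–Baxter weighted walks on rhombic tilings of Glazman–Manolescu, critical for
   every sequence of rhombus angles, whose half-plane two-point function does not depend on the
   angles ("`G_Θ(a,b) = G_{π/3}(a,b)`", arXiv p. 4, Theorem 1) — is robustness in a model
   parameter at criticality, not in the fugacity, and is outside the technique class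
   [cite: GlazmanManolescu2017, Theorem 1].

## Formal content (all proved; one new closed `Prop`, `SupercriticalSAWSpaceFillingProofsClosed`)

`isClosed_setOf_mem_range`, `isClosed_setOf_subset_range` (curve classes through a point / onto
a set form closed sets), `ae_subset_range_of_tendsto` (space-filling probability laws are weakly
closed), `ae_subset_range_map_iff` (transfer to random curves),
`IsSpaceFillingLaws.ae_subset_range_of_iterated`, `IsSpaceFillingLaws.not_isSLELaw_of_iterated`,
`not_isSLELaw_eightThirds_of_supercritical_iterated` (unit disc, closest sites, any
supercritical fugacities), the closed `Prop` `SupercriticalSAWSpaceFillingProofsClosed` and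
`SupercriticalSAWSpaceFillingProofsClosed_holds`.

Mathlib: `MeasureTheory.ProbabilityMeasure.limsup_measure_closed_le_of_tendsto`,
`IsClosed.mem_iff_infDist_zero`, `isClosed_biInter`, `isClosed_le`, `Filter.limsup_congr`,
`Filter.limsup_const`, `MeasureTheory.prob_compl_eq_zero_iff`, `MeasureTheory.ae_map_iff`.

## References (page-level, audit 2026-08-15; pages of the arXiv versions)

* H. Duminil-Copin, G. Kozma, A. Yadin, Ann. IHP Probab. Stat. 50 (2014) 315–326,
  arXiv:1110.3074: p. 2 (§1, weak space-filling; SLE₈; Theorem 1), p. 4 (Proposition 3,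
  Hammersley–Welsh, Lemma 5), p. 8 (§4; Problems 9–10; Conjecture 11). [DuminilCopinKozmaYadin2014]
* G. F. Lawler, O. Schramm, W. Werner, *Conformal restriction: the chordal case*, J. AMS 16
  (2003), arXiv:math/0209343: p. 14, §6, Theorem (Restriction) = Thm 6.1. [LawlerSchrammWerner2003Restriction]
* S. Rohde, O. Schramm, *Basic properties of SLE*, Ann. of Math. 161 (2005), arXiv:math/0106036:
  p. 13, §6, first theorem = Thm 6.1; p. 19 Cor. 25 = Thm 8.1. [RohdeSchramm2005]
* G. F. Lawler, O. Schramm, W. Werner, *On the scaling limit of planar self-avoiding walk* (2004),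
  arXiv:math/0204277: p. 17 Predictions 1–2; p. 18 Appendix. [LawlerSchrammWerner2004SAW]
* A. Kemppainen, S. Smirnov, Ann. Probab. 45 (2017), arXiv:1212.6215: pp. 3, 5, 28. [KemppainenSmirnov2017]
* A. Glazman, I. Manolescu, *Self-avoiding walk on `ℤ²` with Yang–Baxter weights: universality of
  critical fugacity and 2-point function*, Ann. IHP Probab. Stat. 56 (2020) 2281–2300,
  arXiv:1708.00395: p. 4, Theorem 1 (angle-independence of the half-plane 2-point function; the
  "critical fugacity" of the title is the boundary fugacity `1 + √2`, Theorem 2). [GlazmanManolescu2017]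
* P. Billingsley, *Convergence of probability measures*, 2nd ed. (1999), Thm 2.1 (portmanteau,
  closed-set half). [Billingsley1999]
-/

noncomputable section

open MeasureTheory Filter Topology Metric Set Literature.Probability.LatticeModels
  Literature.Probability.Percolation Literature.Probability.RandomPlanarGeometry
  Literature.Probability.RandomPlanarGeometry.SAW
open scoped ENNReal NNReal

namespace Literature.Barriers.CriticalPhenomena

namespace SupercriticalSAW

/-! ### Curves onto a set form a closed set; space-filling laws are weakly closed -/

section Closed

variable {E : Type*} [MetricSpace E]

/-- The curve classes whose (compact) trace passes through a given point form a closed set: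
`z ∈ trace c ⇔ dist(z, trace c) ≤ 0`, a closed condition in `c` (`lipschitzWith_infDist_range`).
[folklore] -/
theorem isClosed_setOf_mem_range (z : E) : IsClosed {c : CurveClass E | z ∈ c.range} := by
  have h : {c : CurveClass E | z ∈ c.range} = {c | infDist z c.range ≤ 0} := by
    ext c
    simp only [mem_setOf_eq]
    rw [c.isCompact_range.isClosed.mem_iff_infDist_zero c.range_nonempty]
    exact ⟨fun h => h.le, fun h => le_antisymm h infDist_nonneg⟩
  rw [h]
  exact isClosed_le (lipschitzWith_infDist_range z).continuous continuous_const

/-- The curve classes onto a set `S` (`S ⊆ trace c`) form a closed set. [folklore] -/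
theorem isClosed_setOf_subset_range (S : Set E) : IsClosed {c : CurveClass E | S ⊆ c.range} := by
  have h : {c : CurveClass E | S ⊆ c.range} = ⋂ z ∈ S, {c | z ∈ c.range} := by
    ext c
    simp only [mem_setOf_eq, mem_iInter, subset_def]
  rw [h]
  exact isClosed_biInter fun z _ => isClosed_setOf_mem_range z

/-- **Space-filling laws are closed under weak convergence.** If probability measures `ν i` on
curve classes converge weakly to `μ` and, eventually along the (non-trivial) filter, `ν i`-almost
every curve is onto `S`, then `μ`-almost every curve is onto `S`: the closed-set half of the
portmanteau theorem (`limsup ν i (F) ≤ μ F` for the closed set `F = {c | S ⊆ trace c}`).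
[cite: Billingsley1999, Thm 2.1] -/
theorem ae_subset_range_of_tendsto {ι : Type*} {l : Filter ι} [l.NeBot]
    {ν : ι → ProbabilityMeasure (CurveClass E)} {μ : ProbabilityMeasure (CurveClass E)}
    (h : Tendsto ν l (𝓝 μ)) {S : Set E}
    (hν : ∀ᶠ i in l, ∀ᵐ c ∂(ν i : Measure (CurveClass E)), S ⊆ c.range) :
    ∀ᵐ c ∂(μ : Measure (CurveClass E)), S ⊆ c.range := by
  set F : Set (CurveClass E) := {c | S ⊆ c.range} with hF
  have hFc : IsClosed F := isClosed_setOf_subset_range S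
  have hlimsup : l.limsup (fun i => (ν i : Measure (CurveClass E)) F) ≤ (μ : Measure (CurveClass E)) F :=
    ProbabilityMeasure.limsup_measure_closed_le_of_tendsto h hFc
  have hev : ∀ᶠ i in l, (ν i : Measure (CurveClass E)) F = 1 := by
    filter_upwards [hν] with i hi
    exact (prob_compl_eq_zero_iff hFc.measurableSet).1 (mem_ae_iff.1 hi)
  have h1 : l.limsup (fun i => (ν i : Measure (CurveClass E)) F) = 1 := by
    rw [limsup_congr hev, limsup_const]
  have hμF : (μ : Measure (CurveClass E)) F = 1 := le_antisymm prob_le_one (h1 ▸ hlimsup)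
  exact mem_ae_iff.2 ((prob_compl_eq_zero_iff hFc.measurableSet).2 hμF)

/-- Transfer between a random curve and its law: `Γ` is a.s. onto `S` iff its law is carried by
curves onto `S` (the set of such curves is closed, hence Borel). [folklore] -/
theorem ae_subset_range_map_iff {Ω' : Type*} [MeasurableSpace Ω'] {W : Measure Ω'}
    {Γ : Ω' → CurveClass E} (hΓ : AEMeasurable Γ W) {S : Set E} :
    (∀ᵐ c ∂W.map Γ, S ⊆ c.range) ↔ ∀ᵐ ω ∂W, S ⊆ (Γ ω).range :=
  ae_map_iff hΓ (isClosed_setOf_subset_range S).measurableSet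

end Closed

/-! ### Iterated limits of weakly space-filling SAW laws -/

section Iterated

variable {κ : ℝ≥0} {D : DobrushinDomain} {ι : Type*} {l : Filter ι} [l.NeBot]
  {A B : ι → ℝ → Site 2}
  {P : ∀ k : ι, ∀ δ : ℝ, Measure (DomainSAW D.carrier δ (A k δ) (B k δ))}
  {Ω' : ι → Type*} [∀ k, MeasurableSpace (Ω' k)] {W : ∀ k, Measure (Ω' k)}
  {Γ : ∀ k, Ω' k → CurveClass ℂ} {ν : ι → ProbabilityMeasure (CurveClass ℂ)}
  {μ : ProbabilityMeasure (CurveClass ℂ)}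

/-- **Iterated limits of weakly space-filling SAW laws are space-filling.** For each index `k`
let `P k δ` be finite laws on the SAWs of `Ω_δ` from `A k δ` to `B k δ` (e.g. the fugacity-`x_k`
laws, `x_k > x_c`, `x_k → x_c`), weakly space-filling in `Ω = D.carrier` in the sense of
Duminil-Copin–Kozma–Yadin §1 and converging in law (curve topology) as `δ → 0⁺` to a random
curve `Γ k` under a probability measure `W k`, with law `ν k`. If `ν k → μ` weakly along any
non-trivial filter, then `μ`-almost every curve is onto `Ω`: each `ν k` is carried by curves onto
`Ω` (`IsSpaceFillingLaws.ae_carrier_subset_range`, the sharp mechanism of `…ProofsNarrow`) and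
such laws are weakly closed (`ae_subset_range_of_tendsto`).
[cite: DuminilCopinKozmaYadin2014, §1 (When x > 1/μ)] -/
theorem IsSpaceFillingLaws.ae_subset_range_of_iterated [∀ k, IsProbabilityMeasure (W k)]
    (hP : ∀ k δ, IsFiniteMeasure (P k δ))
    (hfill : ∀ k, IsSpaceFillingLaws D.carrier (A k) (B k) (P k))
    (hΓ : ∀ k, AEMeasurable (Γ k) (W k))
    (hT : ∀ k, TendstoLaw (fun δ (γ : DomainSAW D.carrier δ (A k δ) (B k δ)) => γ.curve)
      (P k) (Γ k) (W k))
    (hν : ∀ k, (ν k : Measure (CurveClass ℂ)) = (W k).map (Γ k)) (hμ : Tendsto ν l (𝓝 μ)) :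
    ∀ᵐ c ∂(μ : Measure (CurveClass ℂ)), D.carrier ⊆ c.range := by
  refine ae_subset_range_of_tendsto hμ (Eventually.of_forall fun k => ?_)
  rw [hν k, ae_subset_range_map_iff (hΓ k)]
  haveI : ∀ δ, IsFiniteMeasure (P k δ) := hP k
  exact (hfill k).ae_carrier_subset_range (hΓ k) (hT k)

/-- **… hence no iterated limit is an SLE_κ law with non-space-filling curves.** Under the
hypotheses of `IsSpaceFillingLaws.ae_subset_range_of_iterated`, if no chordal SLE_κ random
curve of `(D; a, b)` is almost surely onto `D` (every `κ < 8`: the trace has dimension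
`≤ 1 + κ/8 < 2`), the weak limit `μ` is not the chordal SLE_κ law of `(D; a, b)`
(`IsSLELaw`). [cite: DuminilCopinKozmaYadin2014, §1 and Conjecture 11] -/
theorem IsSpaceFillingLaws.not_isSLELaw_of_iterated [∀ k, IsProbabilityMeasure (W k)]
    (hP : ∀ k δ, IsFiniteMeasure (P k δ))
    (hfill : ∀ k, IsSpaceFillingLaws D.carrier (A k) (B k) (P k))
    (hΓ : ∀ k, AEMeasurable (Γ k) (W k))
    (hT : ∀ k, TendstoLaw (fun δ (γ : DomainSAW D.carrier δ (A k δ) (B k δ)) => γ.curve)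
      (P k) (Γ k) (W k))
    (hν : ∀ k, (ν k : Measure (CurveClass ℂ)) = (W k).map (Γ k)) (hμ : Tendsto ν l (𝓝 μ))
    (hκ : ∀ Γ₀ : (ℝ≥0 → ℝ) → CurveClass ℂ, IsSLECurve κ D Γ₀ →
      ¬ ∀ᵐ ω ∂Literature.Probability.Process.preWienerMeasure, D.carrier ⊆ (Γ₀ ω).range) :
    ¬ IsSLELaw κ D (μ : Measure (CurveClass ℂ)) := by
  rintro ⟨Γ₀, hΓ₀, hμeq⟩
  have h := IsSpaceFillingLaws.ae_subset_range_of_iterated hP hfill hΓ hT hν hμ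
  rw [hμeq, ae_subset_range_map_iff hΓ₀.aemeasurable] at h
  exact hκ Γ₀ hΓ₀ h

end Iterated

/-! ### The setting of Theorem 1: the supercritical side gives no access to SLE_{8/3} -/

section UnitDisc

/-- **No access to SLE_{8/3} from the supercritical side, even after `δ → 0`** (unit disc
`(𝔻; 1, -1)`, closest-site endpoints, any family of supercritical fugacities `x k > x_c`, e.g.
`x k ↓ x_c`). If for every `k` the SAW with parameter `x k` converges in law in the curve
topology, as `δ → 0⁺`, to a random curve `Γ k` (law `ν k`), then no weak limit of the `ν k` is
the chordal SLE_{8/3} law of `(𝔻; 1, -1)`. Inputs: Theorem 1 (`DKY2014_thm1_holds`, proved),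
the restriction formula [LSW03, Thm 6.1] (`h61`) and the simplicity of the SLE_{8/3} trace
[RS05, Thm 6.1] (`h₆`), through `IsSLECurve.exists_ball_measure_disjoint_ne_zero`.
[cite: DuminilCopinKozmaYadin2014, Theorem 1] -/
theorem not_isSLELaw_eightThirds_of_supercritical_iterated (h61 : sle_restriction_eightThirds)
    (h₆ : ae_isSimpleTrace_sleTrace_of_le_four (κ := (8 : ℝ≥0) / 3))
    {ι : Type*} {l : Filter ι} [l.NeBot] {x : ι → ℝ} (hx : ∀ k, criticalFugacity < x k)
    {A B : ℝ → Site 2}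
    (hAB : ∀ δ : ℝ, 0 < δ → IsClosestSite unitDisk δ 1 (A δ) ∧ IsClosestSite unitDisk δ (-1) (B δ))
    {Ω' : ι → Type*} [∀ k, MeasurableSpace (Ω' k)] {W : ∀ k, Measure (Ω' k)}
    [∀ k, IsProbabilityMeasure (W k)] {Γ : ∀ k, Ω' k → CurveClass ℂ}
    (hΓ : ∀ k, AEMeasurable (Γ k) (W k))
    (hT : ∀ k, TendstoLaw (fun δ (γ : DomainSAW unitDisk δ (A δ) (B δ)) => γ.curve)
      (fun δ => lawAt (x k) unitDisk δ (A δ) (B δ)) (Γ k) (W k))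
    {ν : ι → ProbabilityMeasure (CurveClass ℂ)}
    (hν : ∀ k, (ν k : Measure (CurveClass ℂ)) = (W k).map (Γ k))
    {μ : ProbabilityMeasure (CurveClass ℂ)} (hμ : Tendsto ν l (𝓝 μ)) :
    ¬ IsSLELaw ((8 : ℝ≥0) / 3) DobrushinDomain.unitDisc (μ : Measure (CurveClass ℂ)) := by
  have hne : (1 : ℂ) ≠ -1 := fun h => by
    have h' := congrArg Complex.re h
    norm_num at h'
  have hfill : ∀ k : ι, IsSpaceFillingLaws DobrushinDomain.unitDisc.carrier (fun δ => A δ)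
      (fun δ => B δ) (fun δ => lawAt (x k) unitDisk δ (A δ) (B δ)) := fun k =>
    isSpaceFillingLaws_lawAt_iff.2
      (isSpaceFillingFamily_of_DKY2014_thm1 DKY2014_thm1_holds (by simp) (by simp) hne hAB (hx k))
  refine IsSpaceFillingLaws.not_isSLELaw_of_iterated (D := DobrushinDomain.unitDisc)
    (A := fun _ => A) (B := fun _ => B) (P := fun k δ => lawAt (x k) unitDisk δ (A δ) (B δ))
    (fun k δ => isFiniteMeasure_lawAt (x k) unitDisk δ (A δ) (B δ)) hfill hΓ hT hν hμ
    fun Γ₀ hΓ₀ => ?_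
  obtain ⟨z, r, hr, hball, hpos⟩ := hΓ₀.exists_ball_measure_disjoint_ne_zero h61 h₆
  exact not_ae_subset_range_of_measure_ne_zero hr hball hpos

end UnitDisc

end SupercriticalSAW

open SupercriticalSAW

/-! ### The audited barrier (third audit) -/

/-- **Barrier `SupercriticalSAWSpaceFillingProofsClosed`** (third audit of the mechanism of
`SupercriticalSAWSpaceFilling`; PROVED below, `SupercriticalSAWSpaceFillingProofsClosed_holds`):
Theorem 1 of Duminil-Copin–Kozma–Yadin together with the closedness statement that completes
the reach of its mechanism in the curve topology — probability laws on curve classes carried by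
curves onto a set `S` are closed under weak convergence — so that not only limits in law at a
fixed supercritical fugacity (`…ProofsNarrow` (A)) but also all their weak limit points as the
fugacity varies (e.g. `x ↓ x_c` AFTER `δ → 0`) are carried by space-filling curves.

BARRIER (structured block, D-0021):
- technique_class: that of `SupercriticalSAWSpaceFillingProofsNarrow` (δ-independent fugacity neighbourhood, conclusion robust in `x`, on the law of the TRACE in the curve topology `d` or the Hausdorff topology `d_H`), now including its ITERATED-LIMIT reading: constructing or identifying the critical curve law as a weak limit, as `x → x_c`, of scaling limits taken at fixed supercritical fugacities [cite: DuminilCopinKozmaYadin2014, Theorem 1]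
- blocks: everything `…ProofsNarrow` blocks, and (proved here: `SupercriticalSAW.ae_subset_range_of_tendsto`, `SupercriticalSAW.IsSpaceFillingLaws.ae_subset_range_of_iterated`, `SupercriticalSAW.IsSpaceFillingLaws.not_isSLELaw_of_iterated`, `SupercriticalSAW.not_isSLELaw_eightThirds_of_supercritical_iterated`) the identification of chordal SLE_{8/3} — or of any law not carried by curves onto the domain, e.g. SLE_κ for `κ < 8` [cite: RohdeSchramm2005, Thm 8.1 (arXiv Cor. 25)] — with ANY weak limit point, along any family of supercritical fugacities and endpoints, of curve-topology scaling limits of weakly space-filling SAW laws, in particular of the fugacity-`x` laws in `𝔻` for `x > 1/μ` [cite: DuminilCopinKozmaYadin2014, Theorem 1]; for SLE_{8/3} in `(𝔻; 1, -1)` this is unconditional but for [cite: LawlerSchrammWerner2003Restriction, Thm. 6.1] and [cite: RohdeSchramm2005, Thm. 6.1]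
- because: `{c | S ⊆ trace c} = ⋂_{z ∈ S} {c | dist(z, trace c) ≤ 0}` is closed (compact traces; `c ↦ dist(z, trace c)` is `1`-Lipschitz), and for a closed set `F` weak convergence gives `limsup ν_k(F) ≤ μ(F)` [cite: Billingsley1999, Thm 2.1]; with `ν_k(F) = 1` (limits of space-filling families are a.s. onto, `…ProofsNarrow`) `μ(F) = 1`
- evasions_known: exactly those of `SupercriticalSAWSpaceFillingNarrow` and `SupercriticalSAWSpaceFillingProofsNarrow` ((i) mesh-coordinated windows — `o(δ²)` equivalent to the sub-problem; (ii) hypotheses/identities open in `x`; (iii) the missing closed formula for `μ(ℤ²)` is immaterial; (iv) prefix / driving-function / Carathéodory-level conclusions — where moreover the iterated limit is as unobstructed as the direct one, SLE_κ driving functions `√κ B` being continuous in `κ`; (v) canonical and half-plane kinetic ensembles); in addition (vi) robustness in a MODEL parameter along the critical manifold is not robustness in the fugacity: the Yang–Baxter weighted walks on rhombic tilings are critical for every sequence of rhombus angles and their half-plane two-point function does not depend on the angles [cite: GlazmanManolescu2017, Theorem 1] — such statements sit at `x = x_c(model)` throughout and Theorem 1 of the source says nothing about them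
- scope_caveats: those of the two earlier audits; the closedness statement is soft and says nothing about the driving-function topology (evasion (iv)); the shrinking blocked window `w₀(δ) → 0` of `…Narrow` remains inexplicit in the tree although the printed proof of Proposition 3 is effective (Lemma 5: `a_n ≥ μⁿ e^{-c√n}` [cite: DuminilCopinKozmaYadin2014, Proposition 3 and Lemma 5], whence a box size `m(x)` polynomial in `(x - x_c)⁻¹` — a reading of the printed proof, not machine-checked), and no explicit window reaches the conjectural crossover `|x - x_c| ≍ δ^{4/3}` [cite: LawlerSchrammWerner2004SAW, Prediction 2]; Problem 10 (the critical walk is not space-filling) is open [cite: DuminilCopinKozmaYadin2014, Problem 10], so none of this says the critical law itself is not space-filling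
- status: established (proved in the tree: `SupercriticalSAWSpaceFillingProofsClosed_holds`); audit gen 3 of `…Proofs` 2026-08-15: CONFIRMED at page level [cite: DuminilCopinKozmaYadin2014, Theorem 1] [cite: LawlerSchrammWerner2003Restriction, Thm. 6.1] [cite: RohdeSchramm2005, Thm. 6.1]

[cite: DuminilCopinKozmaYadin2014, Theorem 1] -/
def SupercriticalSAWSpaceFillingProofsClosed : Prop :=
  SupercriticalSAWSpaceFilling ∧
    ∀ (S : Set ℂ) (ι : Type) (l : Filter ι), l.NeBot →
      ∀ (ν : ι → ProbabilityMeasure (CurveClass ℂ)) (μ : ProbabilityMeasure (CurveClass ℂ)),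
        Tendsto ν l (𝓝 μ) →
          (∀ᶠ i in l, ∀ᵐ c ∂(ν i : Measure (CurveClass ℂ)), S ⊆ c.range) →
            ∀ᵐ c ∂(μ : Measure (CurveClass ℂ)), S ⊆ c.range

/-- **The audited barrier holds**: Theorem 1 is `SupercriticalSAWSpaceFilling_holds`
(`…TilesTheorem6`), the closedness clause is `ae_subset_range_of_tendsto`.
[cite: DuminilCopinKozmaYadin2014, Theorem 1] -/
theorem SupercriticalSAWSpaceFillingProofsClosed_holds : SupercriticalSAWSpaceFillingProofsClosed :=
  ⟨SupercriticalSAWSpaceFilling_holds, fun _ _ _ hl _ _ hμ hν =>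
    haveI := hl
    ae_subset_range_of_tendsto hμ hν⟩

end Literature.Barriers.CriticalPhenomena
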